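import Summits.BirchSwinnertonDyer.Rank1Residual.P2.KrizLiTwistMinimalModels
import Summits.BirchSwinnertonDyer.Rank1Residual.P2.KrizLiMordellBasesMembership
import HarnessLib

/-!
# Cell `bsd-print-cf2` (D-0131 (2) PRINT TIER, leaf CornerF @ `p = 2`), typer ty2 — the minimal model of a
# Kriz–Li twist ON THE NOSE at the four (★)-certified `j = 0` bases ADDITIVE at `2`:
# `972d1 = y² = x³ + 36` (IV*), `1728a1 = y² = x³ + 2`, `1728v1 = y² = x³ − 2` (II), `3888s1 = y² = x³ + 48` (II*)

HONEST FRAMING (cell `bsd-print-cf2`, run/shared/lean/pub/bsd-print-cf2/; verbatim): PARTITION currency only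
— the leaf `Summit.BirchSwinnertonDyer.WAllCornerFTwo` counts when its class theorem is in the kernel BY NAME;
every imported theorem carries its printed hypotheses verbatim. The leaf and crux `InertJZeroOfFacts`
(stmt-BirchSwinnertonDyer-20671) are OPEN AS CLASSES; nothing class-wide is closed; THEOREMS ONLY — no
definition, no named fact; Assumption (★) and the Manin clause of Kriz–Li Thm 5.1 (2) (live at an additive
base) enter only as the displayed binder `hSD : P2.HasKrizLiStarDatum E K` (a CERTIFICATE, lit dossier §14.4).

Companion of `P2/KrizLiTwistMinimalModels.lean` (generic part). For each base `y² = x³ + B` here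
(`B = 36, 2, −2, 48`; conductor `2²·3⁵, 2⁶·3³, 2⁶·3³, 2⁴·3⁵`; the INERT-BAD quadrant of crux 20671), in EXACTLY
the binders of ty2 g3's membership theorems `isIsogenousToKrizLiTwistOfSmallCMBase_of_curveX` (`K` imaginary
quadratic with `d_K ≡ 1 (mod 8)`, `(d_K/3) = 1`, a displayed (★)-datum, `d ∈ 𝒩(E, K)`, `d > 0`,
`d ≡ 1 (mod 12)`):

* `base_criterion_curveX` — `q¹² ∤ 432B²` at every prime (at every ODD prime for `3888s1`: `ord₂ Δ = 12`);
* `quadraticTwist_curveX_eq` — `E^{(d)} = y² = x³ + a₆`, `a₆ = B·d³`, ON THE NOSE (`C = 1`; tree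
  `quadraticTwist_mk_a₆`);
* `isGloballyMinimal_twistModel_curveX` — that model is GLOBALLY MINIMAL for `d` square-free, `d ≡ 1 (mod 12)`
  (`Δ = −432B²d⁶`; Silverman VII.1 Rem. 1.1 at every prime, except `3888s1` at `2`, where `48d³ = 16·3d³`,
  `3d³ ≡ 3 (mod 4)` and Kraus's test of `P2.isGloballyMinimal_sextic_twist_sixteen_mul` decides);
* `analyticRank_eq_one_and_bsdp_two_twistModel_curveX` — the model is elliptic, globally minimal, with
  `ord_{s=1} L = 1 ∧ BSD(·, 2)` BY NAME, granted the seven facts `hKL h33 hS31 hBF hmod hGZK hCassels` of p3's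
  transport and `hSD`.

What a ty3 record glue does with it: decode `r.ainvs = [0,0,0,0,a₆]` and the rechecked `a₆ = B·d³`, feed `d`'s
explicit data to g3's `inN_curveX_of_explicit`, and read off the record's curve ON THE NOSE. Currency
LITERAL-by-name((★)-display); beyond-print theorem: NO. References: [KrizLi2019] Thm 5.1 (2) = arXiv:1606.03172
Thm 1.12, Def 4.1, Thm 4.3; [SilvermanAEC2009] VII.1 Remark 1.1, X.5 Prop. 5.4; [Kraus1989] Prop. 2;
[Cremona1997] Table 1 (972d1, 1728a1, 1728v1, 3888s1); [CreutzMiller2012] Thm 1.1; [BurungaleFlach2024]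
Thm 1.1, Cor. 2; [MilneADT2006] Thm I.7.3; cell dossier §14.4; tree `P2/KrizLiMordellAtTwo`,
`P2/KrizLiNineSeventyTwo`, `P2/KrizLiSeventeenTwentyEight`, `P2/KrizLiMordellBasesMembership` (ty2 g3).
-/

noncomputable section

open scoped Classical

open WeierstrassCurve NumberField Literature.NumberTheory.EllipticCurves
  Literature.NumberTheory.EllipticCurves.Rank1Residual Literature.NumberTheory.EllipticCurves.ModularForms
  Literature.NumberTheory.EllipticCurves.Rank1Residual.X11RankOneCertificates
  Summit.BirchSwinnertonDyer.Rank1Residual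

set_option autoImplicit false

namespace Summit.BirchSwinnertonDyer.Rank1Residual.P2

/-! ## The base criteria (finite checks) -/

/-- The base criterion at `972d1 = y² = x³ + 36`: `q¹² ∤ 432·36² = 2⁸·3⁷`. [cite: Cremona1997, Table 1 (972d1)] -/
theorem base_criterion_curve972d1 : ∀ q : ℕ, q.Prime → ¬ (q : ℤ) ^ 12 ∣ 432 * (36 : ℤ) ^ 2 :=
  not_intCast_pow_twelve_dvd_of_natAbs_eq 559872 3 (by norm_num) (by norm_num) (by norm_num)
    (by intro q hq hq3; have := hq.two_le; interval_cases q <;> norm_num)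

/-- The base criterion at `1728a1 = y² = x³ + 2`: `q¹² ∤ 432·2² = 1728`. [cite: Cremona1997, Table 1 (1728a1)] -/
theorem base_criterion_curve1728a1 : ∀ q : ℕ, q.Prime → ¬ (q : ℤ) ^ 12 ∣ 432 * (2 : ℤ) ^ 2 :=
  not_intCast_pow_twelve_dvd_of_natAbs_eq 1728 1 (by norm_num) (by norm_num) (by norm_num)
    (by intro q hq hq1; have := hq.two_le; omega)

/-- The base criterion at `1728v1 = y² = x³ − 2`: `q¹² ∤ 432·2² = 1728`. [cite: Cremona1997, Table 1 (1728v1)] -/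
theorem base_criterion_curve1728v1 : ∀ q : ℕ, q.Prime → ¬ (q : ℤ) ^ 12 ∣ 432 * (-2 : ℤ) ^ 2 :=
  not_intCast_pow_twelve_dvd_of_natAbs_eq 1728 1 (by norm_num) (by norm_num) (by norm_num)
    (by intro q hq hq1; have := hq.two_le; omega)

/-- The base criterion at `3888s1 = y² = x³ + 48` AWAY FROM `2`: `q¹² ∤ 432·48² = 2¹²·3⁵` for odd `q` (at `2`
Silverman's disjuncts fail — `ord₂ Δ = 12`, `c₄ = 0` — and Kraus decides). [cite: Cremona1997, Table 1 (3888s1)] -/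
theorem base_criterion_curve3888s1 :
    ∀ q : ℕ, q.Prime → q ≠ 2 → ¬ (q : ℤ) ^ 12 ∣ 432 * (16 * (3 : ℤ)) ^ 2 := fun q hq hq2 hd => by
  have h1 := intCast_pow_dvd_iff_pow_dvd_natAbs.mp hd
  norm_num at h1
  have hle : q ^ 12 ≤ 995328 := Nat.le_of_dvd (by norm_num) h1
  have hq4 : q < 4 := by
    by_contra! h4
    exact absurd (le_trans (Nat.pow_le_pow_left h4 12) hle) (by norm_num)
  have := hq.two_le
  interval_cases q
  · exact absurd rfl hq2
  · norm_num at h1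

/-! ## `972d1`, `1728a1`, `1728v1`, `3888s1` (additive at `2`; twist model `y² = x³ + d³B`, `B = 36, 2, −2, 48`) -/

/-- **The twist model `y² = x³ + 36d³ = 972d1^{(d)}` is globally minimal** for `d` square-free, `d ≡ 1 (mod 12)`
(`Δ = −2⁸·3⁷·d⁶`). [cite: SilvermanAEC2009, VII.1 Remark 1.1 and X.5 Prop. 5.4] [cite: Cremona1997, Table 1 (972d1)] -/
theorem isGloballyMinimal_twistModel_curve972d1 {d a6 : ℤ} (ha : a6 = d ^ 3 * 36) (hsq : Squarefree d.natAbs)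
    (hd12 : d % 12 = 1) : (⟨0, 0, 0, 0, (a6 : ℚ)⟩ : WeierstrassCurve ℚ).IsGloballyMinimal := by
  subst ha
  exact isGloballyMinimal_sextic_twist 36 hsq
    (not_dvd_of_natAbs_eq_pow_two_mul_pow_three hd12 (i := 6) (j := 5) (by norm_num)) base_criterion_curve972d1

/-- **The twist model `y² = x³ + 2d³ = 1728a1^{(d)}` is globally minimal** for `d` square-free, `d ≡ 1 (mod 12)`
(`Δ = −2⁶·3³·d⁶`). [cite: SilvermanAEC2009, VII.1 Remark 1.1 and X.5 Prop. 5.4] [cite: Cremona1997, Table 1 (1728a1)] -/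
theorem isGloballyMinimal_twistModel_curve1728a1 {d a6 : ℤ} (ha : a6 = d ^ 3 * 2) (hsq : Squarefree d.natAbs)
    (hd12 : d % 12 = 1) : (⟨0, 0, 0, 0, (a6 : ℚ)⟩ : WeierstrassCurve ℚ).IsGloballyMinimal := by
  subst ha
  exact isGloballyMinimal_sextic_twist 2 hsq
    (not_dvd_of_natAbs_eq_pow_two_mul_pow_three hd12 (i := 5) (j := 3) (by norm_num)) base_criterion_curve1728a1

/-- **The twist model `y² = x³ − 2d³ = 1728v1^{(d)}` is globally minimal** for `d` square-free, `d ≡ 1 (mod 12)`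
(`Δ = −2⁶·3³·d⁶`). [cite: SilvermanAEC2009, VII.1 Remark 1.1 and X.5 Prop. 5.4] [cite: Cremona1997, Table 1 (1728v1)] -/
theorem isGloballyMinimal_twistModel_curve1728v1 {d a6 : ℤ} (ha : a6 = d ^ 3 * (-2)) (hsq : Squarefree d.natAbs)
    (hd12 : d % 12 = 1) : (⟨0, 0, 0, 0, (a6 : ℚ)⟩ : WeierstrassCurve ℚ).IsGloballyMinimal := by
  subst ha
  exact isGloballyMinimal_sextic_twist (-2) hsq
    (not_dvd_of_natAbs_eq_pow_two_mul_pow_three hd12 (i := 5) (j := 3) (by norm_num)) base_criterion_curve1728v1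

/-- **The twist model `y² = x³ + 48d³ = 3888s1^{(d)}` is globally minimal** for `d` square-free, `d ≡ 1 (mod 12)`
(`Δ = −2¹²·3⁵·d⁶`, `c₄ = 0`: Kraus at `2`, `48d³ = 16·3d³`, `3d³ ≡ 3 (mod 4)`; Silverman elsewhere).
[cite: Kraus1989, Prop. 2] [cite: SilvermanAEC2009, VII.1 Remark 1.1 and X.5 Prop. 5.4] [cite: Cremona1997, Table 1 (3888s1)] -/
theorem isGloballyMinimal_twistModel_curve3888s1 {d a6 : ℤ} (ha : a6 = d ^ 3 * 48) (hsq : Squarefree d.natAbs)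
    (hd12 : d % 12 = 1) : (⟨0, 0, 0, 0, (a6 : ℚ)⟩ : WeierstrassCurve ℚ).IsGloballyMinimal := by
  subst ha
  rw [show (48 : ℤ) = 16 * 3 by norm_num]
  exact isGloballyMinimal_sextic_twist_sixteen_mul 3 (by omega) (by norm_num) hsq
    (not_dvd_of_natAbs_eq_pow_two_mul_pow_three hd12 (i := 8) (j := 4) (by norm_num)) base_criterion_curve3888s1

/-- `972d1^{(d)} = y² = x³ + a₆` on the nose for `a₆ = 36d³`. [cite: SilvermanAEC2009, X.5 Prop. 5.4] -/
theorem quadraticTwist_curve972d1_eq {d a6 : ℤ} (ha : a6 = d ^ 3 * 36) :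
    (1 : VariableChange ℚ) • curve972d1.quadraticTwist (d : ℚ) = ⟨0, 0, 0, 0, (a6 : ℚ)⟩ := by
  rw [one_smul, ha, ← quadraticTwist_sextic_intCast 36 d]; push_cast; rfl

/-- `1728a1^{(d)} = y² = x³ + a₆` on the nose for `a₆ = 2d³`. [cite: SilvermanAEC2009, X.5 Prop. 5.4] -/
theorem quadraticTwist_curve1728a1_eq {d a6 : ℤ} (ha : a6 = d ^ 3 * 2) :
    (1 : VariableChange ℚ) • curve1728a1.quadraticTwist (d : ℚ) = ⟨0, 0, 0, 0, (a6 : ℚ)⟩ := by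
  rw [one_smul, ha, ← quadraticTwist_sextic_intCast 2 d]; push_cast; rfl

/-- `1728v1^{(d)} = y² = x³ + a₆` on the nose for `a₆ = −2d³`. [cite: SilvermanAEC2009, X.5 Prop. 5.4] -/
theorem quadraticTwist_curve1728v1_eq {d a6 : ℤ} (ha : a6 = d ^ 3 * (-2)) :
    (1 : VariableChange ℚ) • curve1728v1.quadraticTwist (d : ℚ) = ⟨0, 0, 0, 0, (a6 : ℚ)⟩ := by
  rw [one_smul, ha, ← quadraticTwist_sextic_intCast (-2) d]; push_cast; rfl

/-- `3888s1^{(d)} = y² = x³ + a₆` on the nose for `a₆ = 48d³`. [cite: SilvermanAEC2009, X.5 Prop. 5.4] -/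
theorem quadraticTwist_curve3888s1_eq {d a6 : ℤ} (ha : a6 = d ^ 3 * 48) :
    (1 : VariableChange ℚ) • curve3888s1.quadraticTwist (d : ℚ) = ⟨0, 0, 0, 0, (a6 : ℚ)⟩ := by
  rw [one_smul, ha, ← quadraticTwist_sextic_intCast 48 d]; push_cast; rfl

/-- **`972d1^{(d)}` ON THE NOSE** (binders of `isIsogenousToKrizLiTwistOfSmallCMBase_of_curve972d1`): in any
imaginary quadratic `K` with `d_K ≡ 1 (mod 8)` and `(d_K/3) = 1` carrying a displayed (★)-datum, for
`d ∈ 𝒩(972d1, K)`, `d > 0`, `d ≡ 1 (mod 12)`, the model `y² = x³ + a₆`, `a₆ = 36d³`, is a globally minimal elliptic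
curve with `ord_{s=1} L = 1 ∧ BSD(·, 2)`, granted BY NAME the seven facts (the Manin clause of Thm 5.1 (2), live
at an additive base, is inside `hSD`). [cite: KrizLi2019, Thm. 5.1 (2), Thm. 4.3, Def. 4.1] [cite: CreutzMiller2012, Thm. 1.1]
[cite: BurungaleFlach2024, Thm. 1.1 and Cor. 2] [cite: MilneADT2006, Thm. I.7.3] [cite: SilvermanAEC2009, VII.1 Remark 1.1] -/
theorem analyticRank_eq_one_and_bsdp_two_twistModel_curve972d1 (hKL : KrizLi2019.thm112_bsdTwo_twist)
    (h33 : KrizLi2019.thm33_rank_twist) (hS31 : bsdTriple_of_analyticRank_le_one_of_conductor_lt)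
    (hBF : bsdTriple_of_hasCM_of_L_one_ne_zero) (hmod : hasEntireLFunction_rat)
    (hGZK : rank_eq_analyticRank_of_analyticRank_le_one) (hCassels : bsdRHS_eq_of_isIsogenous)
    {K : Type} [Field K] [NumberField K] (hK : IsImaginaryQuadratic K) (h8 : NumberField.discr K % 8 = 1)
    (h3 : jacobiSym (NumberField.discr K) 3 = 1) (hSD : HasKrizLiStarDatum curve972d1 K)
    {d a6 : ℤ} (ha : a6 = d ^ 3 * 36) (hd : KrizLi2019.InN curve972d1 K d) (hd0 : 0 < d) (hd12 : d % 12 = 1) :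
    ∃ (_ : (⟨0, 0, 0, 0, (a6 : ℚ)⟩ : WeierstrassCurve ℚ).IsElliptic)
      (_ : (⟨0, 0, 0, 0, (a6 : ℚ)⟩ : WeierstrassCurve ℚ).IsGloballyMinimal),
      (⟨0, 0, 0, 0, (a6 : ℚ)⟩ : WeierstrassCurve ℚ).analyticRank = 1 ∧
        BSDp (⟨0, 0, 0, 0, (a6 : ℚ)⟩ : WeierstrassCurve ℚ) 2 := by
  haveI hE : (⟨0, 0, 0, 0, (a6 : ℚ)⟩ : WeierstrassCurve ℚ).IsElliptic :=
    isElliptic_of_j_zero_model (by rw [ha]; exact_mod_cast mul_ne_zero (pow_ne_zero 3 hd0.ne') (by norm_num))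
  haveI hM := isGloballyMinimal_twistModel_curve972d1 ha hd.2.1 hd12
  exact ⟨hE, hM, analyticRank_eq_one_and_bsdp_two_of_smul_twist_of_hasKrizLiStarDatum curve972d1 hKL h33 hS31
    hBF hmod hGZK hCassels hasCM_curve972d1 conductorNorm_curve972d1_lt one_le_mordellWeilRank_curve972d1
    twoTorsion_curve972d1 at_two_curve972d1.2.1 K hK (satisfiesHeegnerHypothesis_curve972d1 hK.1 h8 h3) hSD hd
    (sign_mul_jacobiSym_conductorNorm_curve972d1 hd0 hd12) _ (quadraticTwist_curve972d1_eq ha)⟩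

/-- **`1728a1^{(d)}` ON THE NOSE** (binders of `isIsogenousToKrizLiTwistOfSmallCMBase_of_curve1728a1`): the model
`y² = x³ + a₆`, `a₆ = 2d³`, is a globally minimal elliptic curve with `ord_{s=1} L = 1 ∧ BSD(·, 2)`, granted BY NAME
the seven facts and the displayed (★)-datum. [cite: KrizLi2019, Thm. 5.1 (2), Thm. 4.3, Def. 4.1]
[cite: CreutzMiller2012, Thm. 1.1] [cite: BurungaleFlach2024, Thm. 1.1 and Cor. 2] [cite: MilneADT2006, Thm. I.7.3]
[cite: SilvermanAEC2009, VII.1 Remark 1.1] -/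
theorem analyticRank_eq_one_and_bsdp_two_twistModel_curve1728a1 (hKL : KrizLi2019.thm112_bsdTwo_twist)
    (h33 : KrizLi2019.thm33_rank_twist) (hS31 : bsdTriple_of_analyticRank_le_one_of_conductor_lt)
    (hBF : bsdTriple_of_hasCM_of_L_one_ne_zero) (hmod : hasEntireLFunction_rat)
    (hGZK : rank_eq_analyticRank_of_analyticRank_le_one) (hCassels : bsdRHS_eq_of_isIsogenous)
    {K : Type} [Field K] [NumberField K] (hK : IsImaginaryQuadratic K) (h8 : NumberField.discr K % 8 = 1)
    (h3 : jacobiSym (NumberField.discr K) 3 = 1) (hSD : HasKrizLiStarDatum curve1728a1 K)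
    {d a6 : ℤ} (ha : a6 = d ^ 3 * 2) (hd : KrizLi2019.InN curve1728a1 K d) (hd0 : 0 < d) (hd12 : d % 12 = 1) :
    ∃ (_ : (⟨0, 0, 0, 0, (a6 : ℚ)⟩ : WeierstrassCurve ℚ).IsElliptic)
      (_ : (⟨0, 0, 0, 0, (a6 : ℚ)⟩ : WeierstrassCurve ℚ).IsGloballyMinimal),
      (⟨0, 0, 0, 0, (a6 : ℚ)⟩ : WeierstrassCurve ℚ).analyticRank = 1 ∧
        BSDp (⟨0, 0, 0, 0, (a6 : ℚ)⟩ : WeierstrassCurve ℚ) 2 := by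
  haveI hE : (⟨0, 0, 0, 0, (a6 : ℚ)⟩ : WeierstrassCurve ℚ).IsElliptic :=
    isElliptic_of_j_zero_model (by rw [ha]; exact_mod_cast mul_ne_zero (pow_ne_zero 3 hd0.ne') (by norm_num))
  haveI hM := isGloballyMinimal_twistModel_curve1728a1 ha hd.2.1 hd12
  exact ⟨hE, hM, analyticRank_eq_one_and_bsdp_two_of_smul_twist_of_hasKrizLiStarDatum curve1728a1 hKL h33 hS31
    hBF hmod hGZK hCassels hasCM_curve1728a1 conductorNorm_curve1728a1_lt one_le_mordellWeilRank_curve1728a1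
    twoTorsion_curve1728a1 at_two_curve1728a1.2.1 K hK (satisfiesHeegnerHypothesis_curve1728a1 hK.1 h8 h3) hSD hd
    (sign_mul_jacobiSym_conductorNorm_curve1728a1 hd0 hd12) _ (quadraticTwist_curve1728a1_eq ha)⟩

/-- **`1728v1^{(d)}` ON THE NOSE** (binders of `isIsogenousToKrizLiTwistOfSmallCMBase_of_curve1728v1`): the model
`y² = x³ + a₆`, `a₆ = −2d³`, is a globally minimal elliptic curve with `ord_{s=1} L = 1 ∧ BSD(·, 2)`, granted BY NAME
the seven facts and the displayed (★)-datum. [cite: KrizLi2019, Thm. 5.1 (2), Thm. 4.3, Def. 4.1]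
[cite: CreutzMiller2012, Thm. 1.1] [cite: BurungaleFlach2024, Thm. 1.1 and Cor. 2] [cite: MilneADT2006, Thm. I.7.3]
[cite: SilvermanAEC2009, VII.1 Remark 1.1] -/
theorem analyticRank_eq_one_and_bsdp_two_twistModel_curve1728v1 (hKL : KrizLi2019.thm112_bsdTwo_twist)
    (h33 : KrizLi2019.thm33_rank_twist) (hS31 : bsdTriple_of_analyticRank_le_one_of_conductor_lt)
    (hBF : bsdTriple_of_hasCM_of_L_one_ne_zero) (hmod : hasEntireLFunction_rat)
    (hGZK : rank_eq_analyticRank_of_analyticRank_le_one) (hCassels : bsdRHS_eq_of_isIsogenous)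
    {K : Type} [Field K] [NumberField K] (hK : IsImaginaryQuadratic K) (h8 : NumberField.discr K % 8 = 1)
    (h3 : jacobiSym (NumberField.discr K) 3 = 1) (hSD : HasKrizLiStarDatum curve1728v1 K)
    {d a6 : ℤ} (ha : a6 = d ^ 3 * (-2)) (hd : KrizLi2019.InN curve1728v1 K d) (hd0 : 0 < d) (hd12 : d % 12 = 1) :
    ∃ (_ : (⟨0, 0, 0, 0, (a6 : ℚ)⟩ : WeierstrassCurve ℚ).IsElliptic)
      (_ : (⟨0, 0, 0, 0, (a6 : ℚ)⟩ : WeierstrassCurve ℚ).IsGloballyMinimal),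
      (⟨0, 0, 0, 0, (a6 : ℚ)⟩ : WeierstrassCurve ℚ).analyticRank = 1 ∧
        BSDp (⟨0, 0, 0, 0, (a6 : ℚ)⟩ : WeierstrassCurve ℚ) 2 := by
  haveI hE : (⟨0, 0, 0, 0, (a6 : ℚ)⟩ : WeierstrassCurve ℚ).IsElliptic :=
    isElliptic_of_j_zero_model (by rw [ha]; exact_mod_cast mul_ne_zero (pow_ne_zero 3 hd0.ne') (by norm_num))
  haveI hM := isGloballyMinimal_twistModel_curve1728v1 ha hd.2.1 hd12
  exact ⟨hE, hM, analyticRank_eq_one_and_bsdp_two_of_smul_twist_of_hasKrizLiStarDatum curve1728v1 hKL h33 hS31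
    hBF hmod hGZK hCassels hasCM_curve1728v1 conductorNorm_curve1728v1_lt one_le_mordellWeilRank_curve1728v1
    twoTorsion_curve1728v1 at_two_curve1728v1.2.1 K hK (satisfiesHeegnerHypothesis_curve1728v1 hK.1 h8 h3) hSD hd
    (sign_mul_jacobiSym_conductorNorm_curve1728v1 hd0 hd12) _ (quadraticTwist_curve1728v1_eq ha)⟩

/-- **`3888s1^{(d)}` ON THE NOSE** (binders of `isIsogenousToKrizLiTwistOfSmallCMBase_of_curve3888s1`): the model
`y² = x³ + a₆`, `a₆ = 48d³`, is a globally minimal elliptic curve (Kraus at `2`) with `ord_{s=1} L = 1 ∧ BSD(·, 2)`,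
granted BY NAME the seven facts and the displayed (★)-datum. [cite: KrizLi2019, Thm. 5.1 (2), Thm. 4.3, Def. 4.1]
[cite: CreutzMiller2012, Thm. 1.1] [cite: BurungaleFlach2024, Thm. 1.1 and Cor. 2] [cite: MilneADT2006, Thm. I.7.3]
[cite: Kraus1989, Prop. 2] -/
theorem analyticRank_eq_one_and_bsdp_two_twistModel_curve3888s1 (hKL : KrizLi2019.thm112_bsdTwo_twist)
    (h33 : KrizLi2019.thm33_rank_twist) (hS31 : bsdTriple_of_analyticRank_le_one_of_conductor_lt)
    (hBF : bsdTriple_of_hasCM_of_L_one_ne_zero) (hmod : hasEntireLFunction_rat)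
    (hGZK : rank_eq_analyticRank_of_analyticRank_le_one) (hCassels : bsdRHS_eq_of_isIsogenous)
    {K : Type} [Field K] [NumberField K] (hK : IsImaginaryQuadratic K) (h8 : NumberField.discr K % 8 = 1)
    (h3 : jacobiSym (NumberField.discr K) 3 = 1) (hSD : HasKrizLiStarDatum curve3888s1 K)
    {d a6 : ℤ} (ha : a6 = d ^ 3 * 48) (hd : KrizLi2019.InN curve3888s1 K d) (hd0 : 0 < d) (hd12 : d % 12 = 1) :
    ∃ (_ : (⟨0, 0, 0, 0, (a6 : ℚ)⟩ : WeierstrassCurve ℚ).IsElliptic)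
      (_ : (⟨0, 0, 0, 0, (a6 : ℚ)⟩ : WeierstrassCurve ℚ).IsGloballyMinimal),
      (⟨0, 0, 0, 0, (a6 : ℚ)⟩ : WeierstrassCurve ℚ).analyticRank = 1 ∧
        BSDp (⟨0, 0, 0, 0, (a6 : ℚ)⟩ : WeierstrassCurve ℚ) 2 := by
  haveI hE : (⟨0, 0, 0, 0, (a6 : ℚ)⟩ : WeierstrassCurve ℚ).IsElliptic :=
    isElliptic_of_j_zero_model (by rw [ha]; exact_mod_cast mul_ne_zero (pow_ne_zero 3 hd0.ne') (by norm_num))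
  haveI hM := isGloballyMinimal_twistModel_curve3888s1 ha hd.2.1 hd12
  exact ⟨hE, hM, analyticRank_eq_one_and_bsdp_two_of_smul_twist_of_hasKrizLiStarDatum curve3888s1 hKL h33 hS31
    hBF hmod hGZK hCassels hasCM_curve3888s1 conductorNorm_curve3888s1_lt one_le_mordellWeilRank_curve3888s1
    twoTorsion_curve3888s1 at_two_curve3888s1.2.1 K hK (satisfiesHeegnerHypothesis_curve3888s1 hK.1 h8 h3) hSD hd
    (sign_mul_jacobiSym_conductorNorm_curve3888s1 hd0 hd12) _ (quadraticTwist_curve3888s1_eq ha)⟩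

end Summit.BirchSwinnertonDyer.Rank1Residual.P2

end
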